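import Summits.BirchSwinnertonDyer.Rank1Residual.Additive.MazurTateDivisibilityThree
import Summits.BirchSwinnertonDyer.Rank1Residual.Additive.TwistPartnerRigidityNewform
import HarnessLib

/-!
# `ω_{n−1} ∣ θ_n` at an ADDITIVE prime IS A THEOREM: `Additive.OmegaDvdMazurTateOfAddv` discharged
# (cell `b2b-bsdres`, lane CLASS-CLOSURE, classes O5 ∪ O6 and every additive prime; seat
# `b2b-bsdres-x11b3-p1` GEN 11 as cross-cell pool hand under x11b3 P-POOL R12-38 (b); theorems only)

HONEST FRAMING (cell `b2b-bsdres`, run/shared/lean/b2b/bsd-rank1-residual/, verbatim in every file): the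
goal of the cell is to DELETE the COMBINATION-SHAPED residual classes of the Birch–Swinnerton-Dyer formula
for ALL analytic-rank `≤ 1` elliptic curves over `ℚ` — "full BSD formula for every rank `≤ 1` curve in
class `C`" assembled STRICTLY from published theorems — so that the rank-`≤ 1` remainder becomes exactly
the CONSTRUCTION-SHAPED classes, which are TYPED (missing-input `Prop`s), NOT attempted. This is not
"finishing BSD". Lane CLASS-CLOSURE (O5 / O6 OPEN): research routes; census output is EVIDENCE, never a
Literature fact; nothing is booked; no mark of `RESIDUAL-MAP.md` moves. This file: THEOREMS ONLY (no
definition, no named fact, no `@[conjecture]` node, no `sorry`; net named-fact debt `0`); NO hypothesis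
beyond the TARGET's own binders.

## What is proved

The typed target `Additive.OmegaDvdMazurTateOfAddv` (`Additive/OmegaDvdMazurTateAddv.lean`, cc-typer-5
GEN 2, "a target `Prop` for a prover"; THEOREM IN PRINT: Mazur–Tate 1987 §1, Doyon–Lei Lemma 5.2 /
proof of Cor. 5.3) — for every elliptic `W/ℚ` (globally minimal model), its newform `f`, every prime `p`
of ADDITIVE reduction and every `n ≥ 1`, `ω_{n−1} = (1+T)^{p^{n−1}} − 1` divides the Mazur–Tate element
`θ_n(f) ∈ ℚ[T]` (tree `mazurTateElement f p n`, Pollack's degree-`< p^n` representative) — is a THEOREM: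

* §1 (newform level) `cyclotomicOmega_dvd_mazurTateElement_succ_of_sum_ratPlusSymbol_eq_zero`: for ANY
  `f ∈ S₂(Γ₀(N))` and prime `p` whose rational plus symbol is killed by `U_p`,
  `∑_{d mod p} [s + d/p]⁺_f = 0` for all `s ∈ ℚ`, one has `ω_n ∣ θ_{n+1}(f)` in `ℚ[T]` for every `n`.
  Proof = the tree's own three-term computation `cyclotomicOmega_dvd_mazurTateElement_add`
  (`PlusMinusPAdicLFunctionProofs` §3, Pollack 2003 Def. 6.15 / Mazur–Tate–Teitelbaum §I.10) with ONE
  level instead of two: in `ℚ[T]/(ω_n)`, where `u = 1 + T` has `u^{p^n} = 1`, write `k < p^{n+1}` as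
  `k = t + p^n j`; the classes `η γ^t (γ^{p^n})^j`, `j < p`, form the fibre of
  `ℤ/p^{n+1+e₀} → ℤ/p^{n+e₀}` over `η γ^t` (`γ^{p^n}` has order `p` modulo `p^{n+1+e₀}` and is `≡ 1`
  modulo `p^{n+e₀}`, `orderOf_cyclotomicGenerator`), and the fibre sum `∑_{j<p} [(a + p^{n+e₀} j)/
  p^{n+1+e₀}]⁺ = ∑_{d mod p} [a/p^{n+1+e₀} + d/p]⁺` VANISHES by hypothesis; so `θ_{n+1} ↦ 0`.
* §2 (curve level) **`omegaDvdMazurTateOfAddv_holds : OmegaDvdMazurTateOfAddv`** — the hypothesis of §1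
  at an additive prime is the tree theorem `sum_ratPlusSymbol_add_div_eq_zero_of_addv`
  (`Additive/TwistPartnerRigidityNewform.lean` §2: `a_p(E) = 0` at an additive prime in the
  `U_p`-relation `a_p [r]⁺ = ∑_j [(r+j)/p]⁺`, `intCast_mul_ratPlusSymbol_of_dvd`, `p ∣ N` by
  `dvd_level_of_addv`, rationality by Manin–Drinfeld). The obstacle recorded in the target's docstring
  ("the tree has as yet no Hecke / `U_p` action on `ratPlusSymbol`") no longer exists.
* §3 restrictions through the EXISTING bridges only (no new statement): o5-r1's T1
  `O5.OmegaDvdMazurTateThree` holds (`O5.omegaDvdMazurTateThree_holds`, via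
  `omegaDvdMazurTateThree_of_addv`); o6-r1's `piDivisible` form on class O6
  (`omegaDvd_mazurTate_three_of_classO6'`, via `omegaDvd_mazurTate_three_of_classO6`); the first layer
  `X ∣ θ_1` (`X_dvd_mazurTateElement_one_of_addv'`); and o6-r1 GEN 7's (T8-i)
  `OmegaDvdMazurTateAdditiveThree` (`Additive/MazurTateDivisibilityThree.lean` §2, `@[conjecture]`-tagged
  THEOREM-CANDIDATE) holds (`omegaDvdMazurTateAdditiveThree_holds`, via cc-typer-5's §T dedup bridge
  `omegaDvdMazurTateAdditiveThree_of_ofAddv`). (T8-ii) / the λ-forms / (T7) are NOT touched.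

WORDING (EVIDENCE framing; cc-typer-5 / the o5 / o6 planners rule on `TYPED.md` / `TARGETS.md`; the
node's docstring / status restamp is the typer's pen, not this file's): "`OmegaDvdMazurTateOfAddv` (o5-r1
T1 / o6-r1 `piDivisible` / (T8-i) node of record) is a THEOREM at every additive prime; `θ_n = ω_{n−1}·u_n`,
so LEMMA A (`Iwasawa/LambdaInvariantValuationOmega.lean`) reads `λ(θ_n) = p^{n−1} + λ(u_n)` with its
`OmegaDvdMazurTateOfAddv` binder fed by name; censuses 3 030 / 3 030 (O5) and 169 / 169 (O6) stay
EVIDENCE; nothing booked; no mark; O5 / O6 OPEN."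

References: B. Mazur, J. Tate, Duke Math. J. 54 (1987) §1 ((1.3), the norm relation at `p ∣ N`)
[MazurTate1987]; B. Mazur, J. Tate, J. Teitelbaum, Invent. Math. 84 (1986) §I.4 (4.2), §I.10
[MazurTateTeitelbaum1986Invent]; A. Doyon, A. Lei, Ramanujan J. 58 (2022) Lemma 5.2, Cor. 5.3
[DoyonLei2021]; A. Lei, R. Pollack, N. Pratap, arXiv:2412.16629 Lemma 5.1 [LeiPollackPratap2024];
R. Pollack, Duke Math. J. 118 (2003) Def. 6.15 [Pollack2003].
-/

noncomputable section

open scoped Classical MatrixGroups ModularForm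

open CongruenceSubgroup Polynomial WeierstrassCurve Literature.NumberTheory.EllipticCurves
  Literature.NumberTheory.EllipticCurves.ModularForms
  Literature.NumberTheory.EllipticCurves.Rank1Residual

namespace Summit.BirchSwinnertonDyer.Rank1Residual.Additive

/-! ## §0 Reindexing finite sums (private copies of the tree's folklore helpers) -/

section Reindex

variable {M : Type*} [AddCommMonoid M]

/-- Reindexing a sum over `ℤ/m` by the representatives `0 ≤ a.val < m`. [folklore] -/
private theorem sum_univ_zmod_val' (m : ℕ) [NeZero m] (g : ℕ → M) :
    ∑ a : ZMod m, g a.val = ∑ k ∈ Finset.range m, g k := by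
  refine Finset.sum_bij (fun a _ ↦ a.val) (fun a _ ↦ Finset.mem_range.mpr (ZMod.val_lt a))
    (fun a _ b _ h ↦ ZMod.val_injective m h) (fun k hk ↦ ?_) (fun _ _ ↦ rfl)
  exact ⟨(k : ZMod m), Finset.mem_univ _, ZMod.val_cast_of_lt (Finset.mem_range.mp hk)⟩

/-- `∑_{k < a·b} g(k) = ∑_{j < a} ∑_{t < b} g(t + b·j)` (Euclidean division by `b`). [folklore] -/
private theorem sum_range_mul_eq_sum_sum' (a b : ℕ) (g : ℕ → M) :
    ∑ k ∈ Finset.range (a * b), g k =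
      ∑ j ∈ Finset.range a, ∑ t ∈ Finset.range b, g (t + b * j) := by
  rw [← Fin.sum_univ_eq_sum_range g (a * b),
    ← finProdFinEquiv.sum_comp (fun x : Fin (a * b) ↦ g x), Fintype.sum_prod_type,
    ← Fin.sum_univ_eq_sum_range (fun j ↦ ∑ t ∈ Finset.range b, g (t + b * j)) a]
  refine Finset.sum_congr rfl fun j _ ↦ ?_
  rw [← Fin.sum_univ_eq_sum_range (fun t ↦ g (t + b * j)) b]
  refine Finset.sum_congr rfl fun t _ ↦ ?_
  rw [finProdFinEquiv_apply_val]

end Reindex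

/-! ## §1 Newform level: `U_p [·]⁺_f = 0 ⟹ ω_n ∣ θ_{n+1}(f)` -/

section Newform

variable {N : ℕ} {f : CuspForm (Gamma0 N) 2} {p : ℕ} [Fact p.Prime]

/-- **The fibre sum VANISHES when `U_p` kills the plus symbol.** If `∑_{d mod p} [s + d/p]⁺_f = 0`
for every `s ∈ ℚ`, then for `a mod p^L` the sum of `[b/p^{L+1}]⁺_f` over the `p` lifts `b` of `a` to
`ℤ/p^{L+1}` is `0`: the lifts are `a + p^L j`, `j < p` (`filter_castHom_eq_image`), and
`(a + p^L j)/p^{L+1} = a/p^{L+1} + j/p`. (Mazur–Tate–Teitelbaum 1986 §I.10 (10.2) with `a_p = 0` at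
`p ∣ N`: `π_{L+1/L} θ_{L+1} = a_p θ_L = 0`.) [cite: MazurTateTeitelbaum1986Invent, §I.10 Prop. (10.2)] -/
theorem sum_fiber_ratPlusSymbol_eq_zero_of_sum_eq_zero
    (hU : ∀ s : ℚ, ∑ d : ZMod p, ratPlusSymbol f (s + (d.val : ℚ) / p) = 0) {L L' : ℕ}
    (hL : L' = L + 1) (hdvd : p ^ L ∣ p ^ L') (a : ZMod (p ^ L)) :
    ∑ b ∈ Finset.univ.filter (fun b : ZMod (p ^ L') ↦ ZMod.castHom hdvd (ZMod (p ^ L)) b = a),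
        ratPlusSymbol f ((b.val : ℚ) / (p : ℚ) ^ L') = 0 := by
  classical
  subst hL
  have hp : p.Prime := Fact.out
  haveI : NeZero p := ⟨hp.ne_zero⟩
  have hp0 : (p : ℚ) ≠ 0 := Nat.cast_ne_zero.mpr hp.ne_zero
  have hinj : Function.Injective
      (fun j : Fin p ↦ ((a.val + p ^ L * (j : ℕ) : ℕ) : ZMod (p ^ (L + 1)))) := by
    intro j j' h
    have hv := congr_arg ZMod.val h
    simp only [val_classLift] at hv
    exact Fin.ext (Nat.eq_of_mul_eq_mul_left (pow_pos hp.pos L) (by omega))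
  rw [filter_castHom_eq_image, Finset.sum_image fun j _ j' _ h ↦ hinj h]
  set s : ℚ := (a.val : ℚ) / (p : ℚ) ^ (L + 1) with hs
  have hA : ∀ j : Fin p,
      ((a.val + p ^ L * (j : ℕ) : ℕ) : ℚ) / (p : ℚ) ^ (L + 1) = s + ((j : ℕ) : ℚ) / p := by
    intro j
    rw [hs]
    push_cast
    field_simp
    ring
  have hH := hU s
  rw [← sum_fin_eq_sum_zmod_val (fun k : ℕ ↦ ratPlusSymbol f (s + (k : ℚ) / p))] at hH
  rw [← hH]
  refine Finset.sum_congr rfl fun j _ ↦ ?_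
  rw [val_classLift, hA]

/-- The fibre of `ℤ/p^{L+1} → ℤ/p^L` over any class has exactly `p` elements. [folklore] -/
private theorem card_filter_castHom_eq' {L L' : ℕ} (hL : L' = L + 1) (hdvd : p ^ L ∣ p ^ L')
    (a : ZMod (p ^ L)) :
    (Finset.univ.filter (fun b : ZMod (p ^ L') ↦ ZMod.castHom hdvd (ZMod (p ^ L)) b = a)).card
      = p := by
  classical
  subst hL
  have hp : p.Prime := Fact.out
  have hinj : Function.Injective
      (fun j : Fin p ↦ ((a.val + p ^ L * (j : ℕ) : ℕ) : ZMod (p ^ (L + 1)))) := by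
    intro j j' h
    have hv := congr_arg ZMod.val h
    simp only [val_classLift] at hv
    exact Fin.ext (Nat.eq_of_mul_eq_mul_left (pow_pos hp.pos L) (by omega))
  rw [filter_castHom_eq_image, Finset.card_image_of_injective _ hinj, Finset.card_univ,
    Fintype.card_fin]

/-- **An orbit of `δ = γ^{p^{n}}` is a fibre.** Let `b₀` be a unit of `ℤ/p^{L+1}` and `δ` an element
of order `p` reducing to `1` modulo `p^L`; then `{b₀ δ^j : j < p}` is exactly the fibre of
`ℤ/p^{L+1} → ℤ/p^L` over `b₀ mod p^L` (both have `p` elements). [folklore] -/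
private theorem image_mul_pow_eq_filter' {L L' : ℕ} (hL : L' = L + 1) (hdvd : p ^ L ∣ p ^ L')
    {b₀ δ : ZMod (p ^ L')} (hb₀ : IsUnit b₀) (hδ : orderOf δ = p)
    (hδ1 : ZMod.castHom hdvd (ZMod (p ^ L)) δ = 1) :
    Finset.univ.image (fun j : Fin p ↦ b₀ * δ ^ (j : ℕ)) =
      Finset.univ.filter (fun b : ZMod (p ^ L') ↦
        ZMod.castHom hdvd (ZMod (p ^ L)) b = ZMod.castHom hdvd (ZMod (p ^ L)) b₀) := by
  classical
  have hinj : Function.Injective (fun j : Fin p ↦ b₀ * δ ^ (j : ℕ)) := by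
    intro j j' h
    have h1 : δ ^ (j : ℕ) = δ ^ (j' : ℕ) := hb₀.mul_right_inj.mp h
    have h2 := pow_injOn_Iio_orderOf (x := δ) (by rw [hδ]; exact j.2) (by rw [hδ]; exact j'.2) h1
    exact Fin.ext h2
  refine Finset.eq_of_subset_of_card_le (fun b hb ↦ ?_) ?_
  · obtain ⟨j, -, rfl⟩ := Finset.mem_image.mp hb
    simp only [Finset.mem_filter, Finset.mem_univ, true_and, map_mul, map_pow, hδ1, one_pow,
      mul_one]
  · rw [card_filter_castHom_eq' hL hdvd, Finset.card_image_of_injective _ hinj, Finset.card_univ,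
      Fintype.card_fin]

/-- **Orbit form of the vanishing fibre sum**: with `b₀`, `δ` as in `image_mul_pow_eq_filter'` and
`U_p [·]⁺_f = 0`, `∑_{j<p} [b₀δ^j / p^{L+1}]⁺_f = 0`. [folklore] -/
private theorem sum_range_ratPlusSymbol_orbit_eq_zero
    (hU : ∀ s : ℚ, ∑ d : ZMod p, ratPlusSymbol f (s + (d.val : ℚ) / p) = 0) {L L' : ℕ}
    (hL : L' = L + 1) (hdvd : p ^ L ∣ p ^ L') {b₀ δ : ZMod (p ^ L')} (hb₀ : IsUnit b₀)
    (hδ : orderOf δ = p) (hδ1 : ZMod.castHom hdvd (ZMod (p ^ L)) δ = 1) :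
    ∑ j ∈ Finset.range p, ratPlusSymbol f (((b₀ * δ ^ j).val : ℚ) / (p : ℚ) ^ L') = 0 := by
  classical
  have hinj : Function.Injective (fun j : Fin p ↦ b₀ * δ ^ (j : ℕ)) := by
    intro j j' h
    have h1 : δ ^ (j : ℕ) = δ ^ (j' : ℕ) := hb₀.mul_right_inj.mp h
    have h2 := pow_injOn_Iio_orderOf (x := δ) (by rw [hδ]; exact j.2) (by rw [hδ]; exact j'.2) h1
    exact Fin.ext h2
  rw [← sum_fiber_ratPlusSymbol_eq_zero_of_sum_eq_zero hU hL hdvd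
      (ZMod.castHom hdvd (ZMod (p ^ L)) b₀), ← image_mul_pow_eq_filter' hL hdvd hb₀ hδ hδ1,
    Finset.sum_image fun j _ j' _ h ↦ hinj h,
    ← Fin.sum_univ_eq_sum_range (fun j ↦ ratPlusSymbol f (((b₀ * δ ^ j).val : ℚ) / (p : ℚ) ^ L')) p]

/-- The image of `θ_m` under a ring homomorphism `φ : ℚ[T] → R`:
`φ(θ_m) = ∑_η ∑_{k < p^m} φ([η γ^k / p^{m+e₀}]⁺) · φ(1+T)^k` (private copy of the tree's unfolding
lemma for Pollack's representative). [cite: Pollack2003, Def. 6.15] -/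
private theorem map_mazurTateElement_eq' {R : Type*} [CommRing R] (φ : ℚ[X] →+* R) (m : ℕ)
    [Fintype (rootsOfUnity (torsionOrder p) ℤ_[p])] :
    φ (mazurTateElement f p m) =
      ∑ w : rootsOfUnity (torsionOrder p) ℤ_[p], ∑ k ∈ Finset.range (p ^ m),
        φ (C (ratPlusSymbol f
          (((PadicInt.toZModPow (m + cyclotomicExponent p) ((w : ℤ_[p]ˣ) : ℤ_[p]) *
              (cyclotomicGenerator p : ZMod (p ^ (m + cyclotomicExponent p))) ^ k).val : ℚ) /
            (p : ℚ) ^ (m + cyclotomicExponent p)))) * φ (X + 1) ^ k := by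
  classical
  haveI : NeZero (p ^ m) := ⟨pow_ne_zero _ (Fact.out : p.Prime).ne_zero⟩
  rw [mazurTateElement, finsum_eq_sum_of_fintype, map_sum]
  refine Finset.sum_congr rfl fun w _ ↦ ?_
  rw [map_sum, ← sum_univ_zmod_val' (p ^ m) (fun k ↦ φ (C (ratPlusSymbol f
          (((PadicInt.toZModPow (m + cyclotomicExponent p) ((w : ℤ_[p]ˣ) : ℤ_[p]) *
              (cyclotomicGenerator p : ZMod (p ^ (m + cyclotomicExponent p))) ^ k).val : ℚ) /
            (p : ℚ) ^ (m + cyclotomicExponent p)))) * φ (X + 1) ^ k)]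
  refine Finset.sum_congr rfl fun s _ ↦ ?_
  rw [map_mul, map_pow]

/-- **`U_p [·]⁺_f = 0 ⟹ ω_n ∣ θ_{n+1}(f)` in `ℚ[T]`** — the norm relation of the Mazur–Tate
elements at a prime DIVIDING the level with eigenvalue `0` (Mazur–Tate 1987 (1.3); Mazur–Tate–Teitelbaum
1986 §I.10: `π_{n+1/n}(θ_{n+1}) = a_p θ_n`, no `ν`-term at `p ∣ N`), stated over the tree's rational
plus symbol: if `∑_{d mod p} [s + d/p]⁺_f = 0` for all `s ∈ ℚ`, then
`((1+T)^{p^n} − 1) ∣ θ_{n+1}(f, T)` for every `n`.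
Proof: in `ℚ[T]/(ω_n)`, where `u = 1 + T` has `u^{p^n} = 1`, write `k < p^{n+1}` as `k = t + p^n j`;
the classes `η γ^t · (γ^{p^n})^j`, `j < p`, form the fibre of `ℤ/p^{n+1+e₀} → ℤ/p^{n+e₀}` over
`η γ^t` (`γ^{p^n}` has order `p` modulo `p^{n+1+e₀}` and is `≡ 1 (mod p^{n+e₀})`,
`orderOf_cyclotomicGenerator`), so each `t`-coefficient is a fibre sum, which vanishes
(`sum_range_ratPlusSymbol_orbit_eq_zero`). [cite: MazurTate1987, §1 (1.3)]
[cite: MazurTateTeitelbaum1986Invent, §I.10 Prop. (10.2)] [cite: DoyonLei2021, Lemma 5.2] -/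
theorem cyclotomicOmega_dvd_mazurTateElement_succ_of_sum_ratPlusSymbol_eq_zero
    (hU : ∀ s : ℚ, ∑ d : ZMod p, ratPlusSymbol f (s + (d.val : ℚ) / p) = 0) (n : ℕ) :
    (cyclotomicOmega p n).map (Int.castRingHom ℚ) ∣ mazurTateElement f p (n + 1) := by
  classical
  have hp : p.Prime := Fact.out
  haveI := neZero_torsionOrder p
  haveI := Fintype.ofFinite (rootsOfUnity (torsionOrder p) ℤ_[p])
  -- the two levels `S = n + e₀ < B = n + 1 + e₀`
  have hBS : n + 1 + cyclotomicExponent p = (n + cyclotomicExponent p) + 1 := by omega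
  have hdvdBS : p ^ (n + cyclotomicExponent p) ∣ p ^ (n + 1 + cyclotomicExponent p) :=
    pow_dvd_pow p (by omega)
  -- the quotient ring `ℚ[T]/(ω_n)` and `u = 1 + T`
  set ωQ : ℚ[X] := (cyclotomicOmega p n).map (Int.castRingHom ℚ) with hωQ
  rw [← AdjoinRoot.mk_eq_zero]
  set π : ℚ[X] →+* AdjoinRoot ωQ := AdjoinRoot.mk ωQ with hπ
  set u : AdjoinRoot ωQ := π (X + 1) with hu
  have hu1 : u ^ p ^ n = 1 := by
    have hω : ((X : ℚ[X]) + 1) ^ p ^ n - 1 = ωQ := by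
      rw [hωQ, cyclotomicOmega, Polynomial.map_sub, Polynomial.map_pow, Polynomial.map_add,
        Polynomial.map_X, Polynomial.map_one]
    have h0 : π (((X : ℚ[X]) + 1) ^ p ^ n - 1) = 0 := by
      rw [hω]
      exact AdjoinRoot.mk_self
    rw [map_sub, map_pow, map_one, sub_eq_zero] at h0
    rw [hu, h0]
  have hupow : ∀ a b : ℕ, u ^ (a + p ^ n * b) = u ^ a := fun a b ↦ by
    rw [pow_add, pow_mul, hu1, one_pow, mul_one]
  -- `γ` at the two levels: `δ = γ^{p^n}` has order `p` at level `B` and is `1` at level `S`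
  have hγS : (cyclotomicGenerator p : ZMod (p ^ (n + cyclotomicExponent p))) ^ p ^ n = 1 := by
    rw [← orderOf_cyclotomicGenerator p n, pow_orderOf_eq_one]
  have hδord : orderOf ((cyclotomicGenerator p :
      ZMod (p ^ (n + 1 + cyclotomicExponent p))) ^ p ^ n) = p := by
    rw [orderOf_pow' _ (pow_ne_zero _ hp.ne_zero), orderOf_cyclotomicGenerator p (n + 1),
      Nat.gcd_eq_right (pow_dvd_pow p (by omega : n ≤ n + 1)), Nat.pow_div (by omega) hp.pos,
      show n + 1 - n = 1 by omega, pow_one]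
  have hδ1 : ZMod.castHom hdvdBS (ZMod (p ^ (n + cyclotomicExponent p)))
      ((cyclotomicGenerator p : ZMod (p ^ (n + 1 + cyclotomicExponent p))) ^ p ^ n) = 1 := by
    rw [map_pow, map_natCast, hγS]
  -- `π(θ_{n+1}) = 0`
  rw [map_mazurTateElement_eq' π (n + 1), ← hu]
  refine Finset.sum_eq_zero fun w _ ↦ ?_
  rw [show p ^ (n + 1) = p * p ^ n by ring, sum_range_mul_eq_sum_sum', Finset.sum_comm]
  refine Finset.sum_eq_zero fun t _ ↦ ?_
  simp_rw [hupow t]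
  rw [← Finset.sum_mul, ← map_sum, ← map_sum]
  -- the orbit sum over `j < p` vanishes
  set b₀ : ZMod (p ^ (n + 1 + cyclotomicExponent p)) :=
    PadicInt.toZModPow (n + 1 + cyclotomicExponent p) ((w : ℤ_[p]ˣ) : ℤ_[p]) *
      (cyclotomicGenerator p : ZMod (p ^ (n + 1 + cyclotomicExponent p))) ^ t with hb₀
  have hb₀u : IsUnit b₀ :=
    ((Units.isUnit _).map _).mul ((isUnit_cyclotomicGenerator_cast p _).pow _)
  have horb := sum_range_ratPlusSymbol_orbit_eq_zero hU hBS hdvdBS hb₀u hδord hδ1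
  have hre : ∀ j : ℕ,
      PadicInt.toZModPow (n + 1 + cyclotomicExponent p) ((w : ℤ_[p]ˣ) : ℤ_[p]) *
          (cyclotomicGenerator p : ZMod (p ^ (n + 1 + cyclotomicExponent p))) ^ (t + p ^ n * j) =
        b₀ * ((cyclotomicGenerator p : ZMod (p ^ (n + 1 + cyclotomicExponent p))) ^ p ^ n) ^ j := by
    intro j
    rw [hb₀, pow_add (cyclotomicGenerator p : ZMod (p ^ (n + 1 + cyclotomicExponent p))) t (p ^ n * j),
      pow_mul (cyclotomicGenerator p : ZMod (p ^ (n + 1 + cyclotomicExponent p))) (p ^ n) j, mul_assoc]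
  simp_rw [hre]
  rw [horb, C_0, map_zero, zero_mul]

end Newform

/-! ## §2 Curve level: the target `OmegaDvdMazurTateOfAddv` -/

section Curve

/-- **`Additive.OmegaDvdMazurTateOfAddv` HOLDS** (Mazur–Tate 1987 §1; Doyon–Lei 2022 Lemma 5.2 / proof of
Cor. 5.3; typed target of `Additive/OmegaDvdMazurTateAddv.lean`, binders verbatim): for every elliptic
`W/ℚ` (globally minimal), its newform `f` (`IsNewformOf W f`), every prime `p` of ADDITIVE reduction
(`Addv W p`) and every `n ≥ 1`, `ω_{n−1} ∣ θ_n(f)` in `ℚ[T]`. Proof: §1 with the `U_p`-vanishing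
`∑_{d mod p} [s + d/p]⁺_f = 0` of `sum_ratPlusSymbol_add_div_eq_zero_of_addv` (`a_p(E) = 0` at an
additive prime, `p ∣ N_E`). Consequences for the O5 / O6 planners' bookkeeping: `θ_n = ω_{n−1}·u_n`,
`λ(θ_n) = p^{n−1} + λ(u_n)`, `μ(θ_n) = μ(u_n)` (LEMMA A, `Iwasawa/LambdaInvariantValuationOmega.lean`,
now fed by name). Censuses (o5-r1 3 030 / 3 030, o6-r1 169 / 169) stay EVIDENCE; nothing booked.
[cite: DoyonLei2021, Lemma 5.2 and proof of Cor. 5.3] [cite: MazurTate1987, §1]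
[cite: LeiPollackPratap2024, Lemma 5.1] -/
theorem omegaDvdMazurTateOfAddv_holds : OmegaDvdMazurTateOfAddv := by
  intro W _ _ _ f p _ hf hadd n hn
  obtain ⟨m, rfl⟩ : ∃ m, n = m + 1 := ⟨n - 1, by omega⟩
  rw [Nat.add_sub_cancel]
  exact cyclotomicOmega_dvd_mazurTateElement_succ_of_sum_ratPlusSymbol_eq_zero
    (sum_ratPlusSymbol_add_div_eq_zero_of_addv W hf hadd) m

/-- Pointwise form (no `Prop`-node in the statement): at an additive prime `p` of `W`,
`ω_{n−1} ∣ θ_n(f_W)` for all `n ≥ 1`. [cite: DoyonLei2021, Lemma 5.2 and proof of Cor. 5.3] -/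
theorem cyclotomicOmega_dvd_mazurTateElement_of_addv (W : WeierstrassCurve ℚ) [W.IsElliptic]
    [W.IsGloballyMinimal] [NeZero (W.conductorNorm ℤ)] (f : CuspForm (Gamma0 (W.conductorNorm ℤ)) 2)
    (p : ℕ) [Fact p.Prime] (hf : IsNewformOf W f) (hadd : Addv W p) (n : ℕ) (hn : 1 ≤ n) :
    (cyclotomicOmega p (n - 1)).map (Int.castRingHom ℚ) ∣ mazurTateElement f p n :=
  omegaDvdMazurTateOfAddv_holds W f p hf hadd n hn

/-- The first layer, hypothesis-free: at an additive prime `X ∣ θ_1(f_W)` (the augmentation of `θ_1`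
vanishes) — `X_dvd_mazurTateElement_one_of_addv` with its `OmegaDvdMazurTateOfAddv` binder supplied.
[cite: DoyonLei2021, Lemma 5.2 and proof of Cor. 5.3] -/
theorem X_dvd_mazurTateElement_one_of_addv' (W : WeierstrassCurve ℚ) [W.IsElliptic]
    [W.IsGloballyMinimal] [NeZero (W.conductorNorm ℤ)] (f : CuspForm (Gamma0 (W.conductorNorm ℤ)) 2)
    (p : ℕ) [Fact p.Prime] (hf : IsNewformOf W f) (hadd : Addv W p) :
    (X : ℚ[X]) ∣ mazurTateElement f p 1 :=
  X_dvd_mazurTateElement_one_of_addv omegaDvdMazurTateOfAddv_holds W f p hf hadd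

/-- **o6-r1's `piDivisible` on class O6, hypothesis-free** ("`π_{k→k−1} θ_k = 0`", O6-TOWERS (3.1)): on
`ClassO6 W 3`, `ω_{n−1} ∣ θ_n(f, 3)` for all `n ≥ 1` — `omegaDvd_mazurTate_three_of_classO6` with its
`OmegaDvdMazurTateOfAddv` binder supplied. Census 169 / 169 stays EVIDENCE; nothing booked.
[cite: DoyonLei2021, Lemma 5.2 and proof of Cor. 5.3] -/
theorem omegaDvd_mazurTate_three_of_classO6' (W : WeierstrassCurve ℚ) [W.IsElliptic]
    [W.IsGloballyMinimal] [NeZero (W.conductorNorm ℤ)] (f : CuspForm (Gamma0 (W.conductorNorm ℤ)) 2)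
    (hf : IsNewformOf W f) (hO6 : ClassO6 W 3) (n : ℕ) (hn : 1 ≤ n) :
    (cyclotomicOmega 3 (n - 1)).map (Int.castRingHom ℚ) ∣ mazurTateElement f 3 n :=
  omegaDvd_mazurTate_three_of_classO6 omegaDvdMazurTateOfAddv_holds W f hf hO6 n hn

end Curve

end Summit.BirchSwinnertonDyer.Rank1Residual.Additive

/-! ## §3 Restriction to class O5: o5-r1's T1 holds -/

namespace Summit.BirchSwinnertonDyer.Rank1Residual.O5

open Summit.BirchSwinnertonDyer.Rank1Residual.Additive

/-- **o5-r1's T1 `O5.OmegaDvdMazurTateThree` HOLDS** (`O5/O5LayerLaws.lean` §1, "THEOREM-CANDIDATE,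
`U₃`-vanishing"): on class O5 at `3`, `ω_{n−1} ∣ θ_n(f_W)` in `ℚ[X]` for all `n ≥ 1` — the restriction
`omegaDvdMazurTateThree_of_addv` of the node of record, now a theorem. Census 3 030 / 3 030 (o5-r1 kit
j121751 / j121825 / j122348) stays EVIDENCE; nothing booked; O5 OPEN.
[cite: DoyonLei2021, Lemma 5.2 and proof of Cor. 5.3] [cite: MazurTate1987, §1] -/
theorem omegaDvdMazurTateThree_holds : OmegaDvdMazurTateThree :=
  omegaDvdMazurTateThree_of_addv omegaDvdMazurTateOfAddv_holds

end Summit.BirchSwinnertonDyer.Rank1Residual.O5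

/-! ## §4 (T8-i): o6-r1 GEN 7's `OmegaDvdMazurTateAdditiveThree` holds -/

namespace Summit.BirchSwinnertonDyer.Rank1Residual.Additive

/-- **(T8-i) `OmegaDvdMazurTateAdditiveThree` HOLDS** (`Additive/MazurTateDivisibilityThree.lean` §2: o5-r1's
T1 with `ClassO5 W 3` weakened to `Addv W 3`; `@[conjecture]`-tagged THEOREM-CANDIDATE, `U₃`-vanishing):
the `p = 3` instance of the node of record through cc-typer-5's dedup bridge
`omegaDvdMazurTateAdditiveThree_of_ofAddv`. EVIDENCE counts (2 724 O6-FW + 296 dicyclic rows + 12 732 O5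
cells, 0 failures) stay EVIDENCE; (T8-ii) `OmegaSqDvdMazurTateNineThree` and the λ-forms are NOT touched;
nothing booked; O6 OPEN. [cite: MazurTate1987, §1] [cite: DoyonLei2021, Lemma 5.2 and proof of Cor. 5.3] -/
theorem omegaDvdMazurTateAdditiveThree_holds : OmegaDvdMazurTateAdditiveThree :=
  omegaDvdMazurTateAdditiveThree_of_ofAddv omegaDvdMazurTateOfAddv_holds

end Summit.BirchSwinnertonDyer.Rank1Residual.Additive

end
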